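import Summits.BirchSwinnertonDyer.BirchSwinnertonDyer.Theorems.ByReductionTypeAtTwoRankOneAtTwoBigImageOddLocalOneDoorBottomNoInflationDefect
import Summits.BirchSwinnertonDyer.BirchSwinnertonDyer.Theorems.GenusKolyvaginAtTwoGenusPrimitiveSupplyAtTwoTwistingPrimeDepthOne
import Summits.BirchSwinnertonDyer.BirchSwinnertonDyer.Theorems.GenusKolyvaginAtTwoShaCardDvdPowAtTwoRTwoPowerImageOverK
import Summits.BirchSwinnertonDyer.BirchSwinnertonDyer.Theorems.GenusKolyvaginAtTwoGenusPrimitiveSupplyAtTwoDescentSignShaOverImagQuadratic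
import Literature.NumberTheory.EllipticCurves.HeegnerPointsKolyvaginConjugation
import Summits.BirchSwinnertonDyer.BirchSwinnertonDyer.Theorems.GenusKolyvaginAtTwoEquivariantChebotarevAtTwoKummerInvariant
import Summits.BirchSwinnertonDyer.BirchSwinnertonDyer.Theorems.GenusKolyvaginAtTwoGenusPrimitiveSupplyAtTwoPosDiscShallowSwapTypeReadsDepthBit
import Literature.NumberTheory.GaloisRepresentations.AbsGaloisOuterConj
import HarnessLib

/-!
# Route `GenusKolyvaginAtTwo`, crux 25504 (K4Pos = stmt-BirchSwinnertonDyer-31469), positive depth: KUMMER NONDEGENERACY AT `2` —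
# a non-zero class of `H¹(F, E[2])` EVALUATES ONTO `E[2]` on `Γ_{F(E[2])}` when the mod-`2` image contains a `3`-cycle

Seat `bsd-line-gk2-p5` g35 (cell `bsd-f1-sign2`, WIDTH-5 attach), `--supports stmt-BirchSwinnertonDyer-31469 --as helper`.  THEOREMS ONLY (no definition,
no named fact, no `sorry`).  **BSD is NOT proved by this file, no item is closed.**

WHY.  p766882 `SwapRead.exists_bit_ne_zero_of_kummer` flips the positive-depth bit at a transposition-type `σ` GIVEN a Kummer element `h`
(trivial on `E[2]`) translating the half `w′` of `w = y_K/2^{M₀}` by a point `u` that `σ` moves.  This file supplies such elements in the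
`h1Eval`/`torsionFixing` currency of the tree (the open sub-goal «Kummer nondegeneracy» of the K4POS kernel package memo, `Γ_F`-side):

* §1 **`exists_torsionFixing_h1Eval_eq_of_threeCycle`** — `V/F` elliptic, `char F = 0`, some `z ∈ Γ_F` moving every non-zero `2`-torsion point
  (a `3`-cycle on `{T₀,T₁,T₂}`), `x ∈ H¹(F, V[2])`, `x ≠ 0`: **for EVERY `u ∈ V[2]` there is `ρ ∈ Γ_{F(V[2])}` with `[x, ρ] = u`.**  Proof: the values
  `{[x,ρ]}` form a subgroup (`h1Eval_mul`) stable under `z` (`h1Eval_conj`, `Γ_{F(V[2])}` normal), non-zero by Gross's Prop. 9.1 at `2`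
  (`RankOneAtTwoOneDoor.eq_zero_of_forall_h1Eval_two_eq_zero`: `H¹(Gal(F(V[2])/F), V[2]) = 0` under a `3`-cycle); a non-zero `z`-stable subgroup of
  the Klein group `V[2]` under a `3`-cycle is everything (`#V[2] = 4`).
* §2 `exists_torsionFixing_smul_sub_eq_of_threeCycle` — the same for a KUMMER class `κ = [g ↦ gQ − Q]` (`2Q` rational, `κ ≠ 0`): for every
  `u ∈ V[2]` some `ρ ∈ Γ_{F(V[2])}` has **`ρ•Q − Q = u`** (`GenusKolyTwistingPrime.coe_h1Eval_kummerClassTorsion`).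
* §3 `…_of_hasSurjectiveModNGaloisRep_two` — the slice: `ρ̄_{V,2}` onto supplies the `3`-cycle
  (`RankOneAtTwoOneDoor.exists_threeCycle_of_hasSurjectiveModNGaloisRep_two`).
* §4 **`exists_kummer_translate_of_habitat`** (`Γ_ℚ`-side, the habitat frame): `ρ̄_{E,2^n}` onto, `K` imaginary quadratic with odd `d_K` and the
  two non-squares, `Q₀ ∉ 2E(K)`, `w′` a half of `e_*Q₀`: for EVERY `u ∈ E[2]` some `h ∈ Γ_ℚ` fixes `E[2]` and `e_*(E(K))` pointwise and has
  `h•w′ = w′ + u` — EXACTLY the hypotheses `hhw`/`hht`/`hfixh` of p766882 `exists_bit_ne_zero_of_kummer` (via `res : Γ_K → Γ_ℚ`,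
  `RatClosure.pointsEquiv_smul`, `pointsEquiv_map_absEmbedding`).
* §5 **`exists_kummer_bit_ne_zero_of_habitat`** — ASSEMBLED with p766882 `exists_bit_ne_zero_of_kummer`: on the habitat frame, at every
  transposition-type `σ` (acting as `τ` on the point frame, moving some `u ∈ E[2]` with `σ²u = u`) BOTH values of the positive-depth bit occur in the
  coset `σ·Γ_{K(E[2])}` — UNCONDITIONAL (the open sub-goal of the K4POS kernel-package memo is discharged).
* §6 (APPEND) `exists_kummer_bit_eq_zero_of_habitat` — the ZERO value occurs too: translating the half by the defect `t₁` gives `bit(σh) = 2·bit(σ) = 0`.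

READING for K₄⁺/K₄: with `V = E_K`, `Q = w′` a half of `Q₀ = y_K/2^{M₀}` (`Q₀ ∉ 2E(K)` so `κ ≠ 0`, `ker κ = 2E(K)`), and `ρ̄_{E_K,2}` onto
(habitat: `TwoPowerImageOverK.hasSurjectiveModNGaloisRep_two_pow_baseChange_of_habitat`), EVERY translation `w′ ↦ w′ + u`, `u ∈ E[2]`, is realised
by an element of `Γ_{K(E[2])}` — the `hhw` input of the bit flip, on the `Γ_K` side.  Nothing here proves K₄⁺ or BSD.

References: [GrossLMS1991] Prop. 9.1, §4 (4.4); [LawsonWuthrich2016] §7; [SilvermanAEC2009] VIII.§2 (Kummer pairing), III.6.4(b); [Bashmakov1972] §3.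
-/

set_option autoImplicit false
set_option linter.dupNamespace false -- `Summit.<P>.<Sub>` repeats `BirchSwinnertonDyer` (D-0017)

noncomputable section

open scoped Classical

namespace Summit.BirchSwinnertonDyer.BirchSwinnertonDyer.Theorems.GenusSupplyNarrow.SwapRead

open WeierstrassCurve Field
open Literature.NumberTheory.EllipticCurves Literature.NumberTheory.GaloisRepresentations
open Literature.NumberTheory.EllipticCurves.DokchitserDokchitser2012
open Summit.BirchSwinnertonDyer.BirchSwinnertonDyer.Theorems.RankOneAtTwoOneDoor (two_ne_zero_of_charZero'
  eq_zero_of_forall_h1Eval_two_eq_zero exists_threeCycle_of_hasSurjectiveModNGaloisRep_two)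

universe u

variable {F : Type u} [Field F] [CharZero F] (V : WeierstrassCurve F) [V.IsElliptic]

/-! ## §1 A non-zero class evaluates onto `V[2]` -/

/-- A `3`-cycle element moves every non-zero `2`-torsion point. [cite: SilvermanAEC2009, III.§7] -/
theorem smul_ne_self_of_threeCycle {z : absoluteGaloisGroup F} (hz : ∀ i : Fin 3, permGal V two_ne_zero_of_charZero' z i ≠ i)
    (T : geomTorsion V ((2 : ℕ) : ℤ)) (hT : T ≠ 0) : z • T ≠ T := by
  rcases eq_zero_or_eq_T V two_ne_zero_of_charZero' T with h0 | ⟨i, hi⟩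
  · exact absurd h0 hT
  · intro h
    apply hz i
    apply T_injective V two_ne_zero_of_charZero'
    rw [T_permGal, ← hi]
    exact h

omit [CharZero F] in
/-- `#V[2] = 4` as a `Fintype` count (`char F ≠ 2`). [cite: SilvermanAEC2009, Cor. III.6.4(b)] -/
theorem fintype_card_geomTorsion_two_eq_four [Fintype (geomTorsion V ((2 : ℕ) : ℤ))] (h2 : (2 : F) ≠ 0) :
    Fintype.card (geomTorsion V ((2 : ℕ) : ℤ)) = 4 := by
  have h2' : ((2 : ℕ) : AlgebraicClosure F) ≠ 0 := by
    rw [Nat.cast_ofNat]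
    intro h
    apply h2
    apply (algebraMap F (AlgebraicClosure F)).injective
    rw [map_ofNat, map_zero]
    exact h
  rw [Fintype.card_eq_nat_card]
  exact V.card_torsionPoints_eq_sq_holds (AlgebraicClosure F) (n := 2) h2'

omit [CharZero F] [V.IsElliptic] in
/-- `T + T = 0` in `V[2]`. [folklore] -/
theorem add_self_eq_zero_geomTorsion_two (T : geomTorsion V ((2 : ℕ) : ℤ)) : T + T = 0 := by
  rw [← two_nsmul]
  exact AddSubgroup.torsionBy.nsmul T

/-- **KUMMER NONDEGENERACY AT `2` (Gross 9.1 + the Klein group): a non-zero `x ∈ H¹(F, V[2])` evaluates ONTO `V[2]` on `Γ_{F(V[2])}`** when some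
`z ∈ Γ_F` acts on the non-zero `2`-torsion points as a `3`-cycle: for every `u ∈ V[2]` there is `ρ ∈ Γ_{F(V[2])}` with `[x, ρ] = u`.  The values
`[x, ρ]` are closed under addition (`h1Eval_mul`) and under `z` (`h1Eval_conj`: `[x, zρz⁻¹] = z•[x, ρ]`), contain a non-zero `u₁` (else `x = 0` by
`H¹(Gal(F(V[2])/F), V[2]) = 0`), hence `u₁, z u₁ ≠ u₁, u₁ + z u₁` — all of `V[2] ∖ {0}` (`#V[2] = 4`).
[cite: GrossLMS1991, Prop. 9.1] [cite: LawsonWuthrich2016, §7] [cite: SilvermanAEC2009, Cor. III.6.4(b)] -/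
theorem exists_torsionFixing_h1Eval_eq_of_threeCycle
    (hz : ∃ z : absoluteGaloisGroup F, ∀ i : Fin 3, permGal V two_ne_zero_of_charZero' z i ≠ i)
    {x : galH1Torsion V ((2 : ℕ) : ℤ)} (hx : x ≠ 0) (u : geomTorsion V ((2 : ℕ) : ℤ)) :
    ∃ ρ ∈ torsionFixing V ((2 : ℕ) : ℤ), h1Eval V ((2 : ℕ) : ℤ) x ρ = u := by
  haveI : Finite (geomTorsion V ((2 : ℕ) : ℤ)) := V.finite_geomTorsion_nat two_ne_zero
  letI : Fintype (geomTorsion V ((2 : ℕ) : ℤ)) := Fintype.ofFinite _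
  -- a non-zero value
  have hne : ∃ ρ₁ ∈ torsionFixing V ((2 : ℕ) : ℤ), h1Eval V ((2 : ℕ) : ℤ) x ρ₁ ≠ 0 := by
    by_contra h
    apply hx
    refine eq_zero_of_forall_h1Eval_two_eq_zero V hz fun ρ hρ ↦ ?_
    by_contra hρ0
    exact h ⟨ρ, hρ, hρ0⟩
  obtain ⟨ρ₁, hρ₁, hu₁⟩ := hne
  obtain ⟨z, hz'⟩ := hz
  set u₁ := h1Eval V ((2 : ℕ) : ℤ) x ρ₁ with hu₁def
  -- `z u₁ = [x, z ρ₁ z⁻¹]`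
  have hρ₂ : z * ρ₁ * z⁻¹ ∈ torsionFixing V ((2 : ℕ) : ℤ) := (torsionFixing_normal V _).conj_mem ρ₁ hρ₁ z
  have hu₂ : h1Eval V ((2 : ℕ) : ℤ) x (z * ρ₁ * z⁻¹) = z • u₁ := h1Eval_conj V _ x z hρ₁
  -- `u₁ + z u₁ = [x, ρ₁ (z ρ₁ z⁻¹)]`
  have hρ₃ : ρ₁ * (z * ρ₁ * z⁻¹) ∈ torsionFixing V ((2 : ℕ) : ℤ) := (torsionFixing V _).mul_mem hρ₁ hρ₂
  have hu₃ : h1Eval V ((2 : ℕ) : ℤ) x (ρ₁ * (z * ρ₁ * z⁻¹)) = u₁ + z • u₁ := by rw [h1Eval_mul V _ x hρ₁, hu₂]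
  -- the four values `0, u₁, z u₁, u₁ + z u₁` are distinct
  have h21 : z • u₁ ≠ u₁ := smul_ne_self_of_threeCycle V hz' u₁ hu₁
  have h20 : z • u₁ ≠ 0 := fun h ↦ hu₁ ((smul_eq_zero_iff_eq z).mp h)
  have h30 : u₁ + z • u₁ ≠ 0 := by
    intro h
    apply h21
    have h' : z • u₁ = -u₁ := eq_neg_of_add_eq_zero_right h
    rw [h', neg_eq_iff_add_eq_zero, add_self_eq_zero_geomTorsion_two]
  have h31 : u₁ + z • u₁ ≠ u₁ := fun h ↦ h20 (by simpa using h)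
  have h32 : u₁ + z • u₁ ≠ z • u₁ := fun h ↦ hu₁ (by simpa using h)
  -- so they exhaust `V[2]`
  have hS : ({0, u₁, z • u₁, u₁ + z • u₁} : Finset (geomTorsion V ((2 : ℕ) : ℤ))).card = 4 := by
    rw [Finset.card_insert_of_notMem, Finset.card_insert_of_notMem, Finset.card_pair h32.symm]
    · simp only [Finset.mem_insert, Finset.mem_singleton, not_or]
      exact ⟨h21.symm, h31.symm⟩
    · simp only [Finset.mem_insert, Finset.mem_singleton, not_or]
      exact ⟨hu₁.symm, h20.symm, h30.symm⟩
  have huniv : ({0, u₁, z • u₁, u₁ + z • u₁} : Finset (geomTorsion V ((2 : ℕ) : ℤ))) = Finset.univ :=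
    Finset.eq_univ_of_card _ (hS.trans (fintype_card_geomTorsion_two_eq_four V two_ne_zero_of_charZero').symm)
  have hu : u ∈ ({0, u₁, z • u₁, u₁ + z • u₁} : Finset (geomTorsion V ((2 : ℕ) : ℤ))) := by
    rw [huniv]; exact Finset.mem_univ u
  simp only [Finset.mem_insert, Finset.mem_singleton] at hu
  rcases hu with rfl | rfl | rfl | rfl
  · exact ⟨1, (torsionFixing V _).one_mem, h1Eval_one V _ x⟩
  · exact ⟨ρ₁, hρ₁, rfl⟩
  · exact ⟨z * ρ₁ * z⁻¹, hρ₂, hu₂⟩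
  · exact ⟨ρ₁ * (z * ρ₁ * z⁻¹), hρ₃, hu₃⟩

/-! ## §2 Kummer classes: every translation of a half is realised on `Γ_{F(V[2])}` -/

/-- **Every translation `Q ↦ Q + u`, `u ∈ V[2]`, of a half `Q` of a rational point is realised by an element of `Γ_{F(V[2])}`** as soon as the
Kummer class `κ = [g ↦ gQ − Q] ∈ H¹(F, V[2])` is non-zero (i.e. `2Q ∉ 2V(F)`) and the mod-`2` image contains a `3`-cycle:
`∃ ρ ∈ Γ_{F(V[2])}, ρ•Q − Q = u`.  (§1 + `[κ, ρ] = ρQ − Q` on `Γ_{F(V[2])}`, `GenusKolyTwistingPrime.coe_h1Eval_kummerClassTorsion`.)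
[cite: SilvermanAEC2009, VIII.§2] [cite: GrossLMS1991, Prop. 9.1] -/
theorem exists_torsionFixing_smul_sub_eq_of_threeCycle
    (hz : ∃ z : absoluteGaloisGroup F, ∀ i : Fin 3, permGal V two_ne_zero_of_charZero' z i ≠ i)
    (Q : geomPoints V) (hQ : ((2 : ℕ) : ℤ) • Q ∈ MulAction.fixedPoints (absoluteGaloisGroup F) (geomPoints V))
    (hκ : V.kummerClassTorsion ((2 : ℕ) : ℤ) Q hQ ≠ 0) (u : geomTorsion V ((2 : ℕ) : ℤ)) :
    ∃ ρ ∈ torsionFixing V ((2 : ℕ) : ℤ), ρ • Q - Q = (u : geomPoints V) := by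
  obtain ⟨ρ, hρ, hρu⟩ := exists_torsionFixing_h1Eval_eq_of_threeCycle V hz hκ u
  refine ⟨ρ, hρ, ?_⟩
  rw [← GenusKolyTwistingPrime.coe_h1Eval_kummerClassTorsion V ((2 : ℕ) : ℤ) Q hQ hρ, hρu]

/-! ## §3 The slice: `ρ̄_{V,2}` onto -/

/-- **§1 on the slice `ρ̄_{V,2}` onto** (`GL₂(𝔽₂) ≅ S₃` contains a `3`-cycle). [cite: GrossLMS1991, Prop. 9.1] [cite: DokchitserDokchitserMathZ2012, Theorem (1)] -/
theorem exists_torsionFixing_h1Eval_eq_of_hasSurjectiveModNGaloisRep_two (hs : V.HasSurjectiveModNGaloisRep 2)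
    {x : galH1Torsion V ((2 : ℕ) : ℤ)} (hx : x ≠ 0) (u : geomTorsion V ((2 : ℕ) : ℤ)) :
    ∃ ρ ∈ torsionFixing V ((2 : ℕ) : ℤ), h1Eval V ((2 : ℕ) : ℤ) x ρ = u :=
  exists_torsionFixing_h1Eval_eq_of_threeCycle V (exists_threeCycle_of_hasSurjectiveModNGaloisRep_two V hs) hx u

/-- **§2 on the slice `ρ̄_{V,2}` onto.** [cite: SilvermanAEC2009, VIII.§2] [cite: GrossLMS1991, Prop. 9.1] -/
theorem exists_torsionFixing_smul_sub_eq_of_hasSurjectiveModNGaloisRep_two (hs : V.HasSurjectiveModNGaloisRep 2)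
    (Q : geomPoints V) (hQ : ((2 : ℕ) : ℤ) • Q ∈ MulAction.fixedPoints (absoluteGaloisGroup F) (geomPoints V))
    (hκ : V.kummerClassTorsion ((2 : ℕ) : ℤ) Q hQ ≠ 0) (u : geomTorsion V ((2 : ℕ) : ℤ)) :
    ∃ ρ ∈ torsionFixing V ((2 : ℕ) : ℤ), ρ • Q - Q = (u : geomPoints V) :=
  exists_torsionFixing_smul_sub_eq_of_threeCycle V (exists_threeCycle_of_hasSurjectiveModNGaloisRep_two V hs) Q hQ hκ u

/-! ## §4 The `Γ_ℚ`-side on the habitat frame: every translation of a half of `e_* Q₀` by a `2`-torsion point is a Kummer element -/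

section Frame

variable (W : WeierstrassCurve ℚ) [W.IsElliptic] {K : Type} [Field K] [NumberField K]
  (e : (W.baseChange K).toAffine.Point →+ W.geomPoints) (he : e = Affine.Point.map (W' := W) (absEmbedding ℚ K))

omit [W.IsElliptic] in
include he in
/-- `θ ∘ e_* = ι_*`: transporting the `ℚ̄`-points of `E(K)` (embedded by `e_* = Affine.Point.map (absEmbedding ℚ K)`) along
`pointsEquiv : E(ℚ̄) ≃ E_K(K̄)` gives the `K̄`-points `toGeomPoints` (`absClosureEmbedding_absEmbedding`). [folklore] -/
theorem pointsEquiv_map_absEmbedding (X : (W.baseChange K).toAffine.Point) :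
    RatClosure.pointsEquiv (K := K) W (e X) = toGeomPoints (W.baseChange K) X := by
  subst he
  rcases X with _ | ⟨x, y, h⟩
  · rfl
  · exact Affine.Point.some_eq_some_of_eq (absClosureEmbedding_absEmbedding ℚ K x) (absClosureEmbedding_absEmbedding ℚ K y)

omit [W.IsElliptic] in
include he in
/-- An element of the embedded `Γ_K` fixes `e_*(E(K))` pointwise. [folklore] -/
theorem absGaloisRestrict_smul_map_absEmbedding (ρ : absoluteGaloisGroup K) (X : (W.baseChange K).toAffine.Point) :
    absGaloisRestrict ℚ K ρ • e X = e X := by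
  apply (RatClosure.pointsEquiv (K := K) W).injective
  rw [RatClosure.pointsEquiv_smul, pointsEquiv_map_absEmbedding W e he, smul_toGeomPoints]

include he in
/-- **KUMMER ELEMENTS ON THE HABITAT FRAME (`Γ_ℚ`-side).**  `W/ℚ` globally minimal elliptic on the habitat (`ρ̄_{E,2^n}` onto for all `n ≥ 1`),
`K` imaginary quadratic with odd `d_K` and the two Theorem-B₂ non-squares (so `ρ̄_{E_K,2}` is onto over `K`,
`TwoPowerImageOverK.hasSurjectiveModNGaloisRep_two_pow_baseChange_of_habitat`), `Q₀ ∈ E(K)` with `Q₀ ∉ 2E(K)`, `w′ ∈ E(ℚ̄)` a half of `e_*Q₀`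
(`e_* = Affine.Point.map (absEmbedding ℚ K)`, passed as the binder `(e, he)`).  Then for EVERY `u ∈ E(ℚ̄)` with `2u = 0` there is `h ∈ Γ_ℚ` which
FIXES EVERY `2`-TORSION POINT, FIXES `e_*(E(K))` POINTWISE, and translates the half: **`h • w′ = w′ + u`** — exactly the input (`hhw`, `hht`,
`hfixh`) of p766882 `SwapRead.exists_bit_ne_zero_of_kummer`.  (`h = res ρ` for the `ρ ∈ Γ_{K(E[2])}` of §2 applied to `θ w′`; equivariance
`RatClosure.pointsEquiv_smul`.)  [cite: GrossLMS1991, Prop. 9.1, §4 (4.4)] [cite: SilvermanAEC2009, VIII.§2] [cite: Serre1972, §5.3] -/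
theorem exists_kummer_translate_of_habitat [W.IsGloballyMinimal] (hK : IsImaginaryQuadratic K) (hodd : Odd (NumberField.discr K))
    (hsq1 : ¬ IsSquare ((NumberField.discr K : ℚ) * -|W.Δ|)) (hsq2 : ¬ IsSquare ((NumberField.discr K : ℚ) * (-(2 * |W.Δ|))))
    (hρ : ∀ n : ℕ, 0 < n → W.HasSurjectiveModNGaloisRep ((2 : ℤ) ^ n))
    {Q₀ : (W.baseChange K).toAffine.Point} (hQ₀ : ¬ ∃ R : (W.baseChange K).toAffine.Point, (2 : ℤ) • R = Q₀)
    {w' : W.geomPoints} (hw' : (2 : ℤ) • w' = e Q₀) (u : W.geomPoints) (hu : (2 : ℤ) • u = 0) :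
    ∃ h : absoluteGaloisGroup ℚ, (∀ T : W.geomPoints, (2 : ℤ) • T = 0 → h • T = T) ∧
      (∀ X : (W.baseChange K).toAffine.Point, h • e X = e X) ∧ h • w' = w' + u := by
  haveI : (W.baseChange K).IsElliptic := by rw [baseChange]; infer_instance
  set θ := RatClosure.pointsEquiv (K := K) W with hθ
  -- the half `Q := θ w′` of the `K`-rational point `ι_* Q₀`
  set Q : geomPoints (W.baseChange K) := θ w' with hQdef
  have h2Q : ((2 : ℕ) : ℤ) • Q = toGeomPoints (W.baseChange K) Q₀ := by
    rw [hQdef, Nat.cast_ofNat, ← map_zsmul, hw', hθ, pointsEquiv_map_absEmbedding W e he]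
  have hQfix : ((2 : ℕ) : ℤ) • Q ∈ MulAction.fixedPoints (absoluteGaloisGroup K) (geomPoints (W.baseChange K)) := by
    rw [h2Q]; exact toGeomPoints_mem_fixedPoints _ Q₀
  -- its Kummer class is `κ₂(Q₀) ≠ 0`
  have hκ : (W.baseChange K).kummerClassTorsion ((2 : ℕ) : ℤ) Q hQfix ≠ 0 := by
    have hne := GenusExact.kummerMapTorsion_ne_zero_of_not_exists (hdiv := GenusKolyArch.hdiv_two_baseChange W K)
      (P := Q₀) (n := ((2 : ℕ) : ℤ)) (by simpa only [Nat.cast_ofNat] using hQ₀)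
    rwa [kummerMapTorsion_apply, kummerMapTorsionFun_eq (W.baseChange K) ((2 : ℕ) : ℤ) (GenusKolyArch.hdiv_two_baseChange W K) Q₀ Q h2Q]
      at hne
  -- surjectivity mod 2 over `K` on the habitat, and §2
  have hs : (W.baseChange K).HasSurjectiveModNGaloisRep 2 := by
    have h := GenusExact.TwoPowerImageOverK.hasSurjectiveModNGaloisRep_two_pow_baseChange_of_habitat W K hK hodd hsq1 hsq2 hρ 1
    rwa [pow_one] at h
  have huθ : ((2 : ℕ) : ℤ) • θ u = 0 := by rw [Nat.cast_ofNat, ← map_zsmul, hu, map_zero]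
  obtain ⟨ρ, hρmem, hρQ⟩ := exists_torsionFixing_smul_sub_eq_of_hasSurjectiveModNGaloisRep_two (W.baseChange K) hs Q hQfix hκ
    ⟨θ u, (mem_geomTorsion_iff _ _ _).mpr huθ⟩
  refine ⟨absGaloisRestrict ℚ K ρ, fun T hT ↦ ?_, fun X ↦ absGaloisRestrict_smul_map_absEmbedding W e he ρ X, ?_⟩
  · -- `res ρ` fixes `E[2]`: `ρ ∈ Γ_{K(E[2])}` fixes `θ T`
    apply θ.injective
    rw [hθ, RatClosure.pointsEquiv_smul]
    have hTθ : ((2 : ℕ) : ℤ) • RatClosure.pointsEquiv (K := K) W T = 0 := by rw [Nat.cast_ofNat, ← map_zsmul, hT, map_zero]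
    have h := smul_eq_of_mem_torsionFixing (W.baseChange K) ((2 : ℕ) : ℤ) hρmem
      ⟨RatClosure.pointsEquiv (K := K) W T, (mem_geomTorsion_iff _ _ _).mpr hTθ⟩
    exact congrArg Subtype.val h
  · -- `res ρ • w′ = w′ + u`
    apply θ.injective
    rw [hθ, RatClosure.pointsEquiv_smul, map_add]
    have h : ρ • Q - Q = θ u := hρQ
    rw [hθ] at h hQdef
    rw [← hQdef]
    rw [sub_eq_iff_eq_add'] at h
    rw [h, add_comm]

end Frame

/-! ## §5 Assembled: BOTH values of the positive-depth bit occur at transposition-type elements (habitat frame, unconditional) -/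

section Both

variable (W : WeierstrassCurve ℚ) [W.IsElliptic] [W.IsGloballyMinimal] {K : Type} [Field K] [NumberField K]
  (e : (W.baseChange K).toAffine.Point →+ W.geomPoints) (he : e = Affine.Point.map (W' := W) (absEmbedding ℚ K))

include he in
/-- **BOTH VALUES OF THE POSITIVE-DEPTH BIT OCCUR IN THE COSET OF A TRANSPOSITION-TYPE ELEMENT — UNCONDITIONALLY ON THE HABITAT FRAME.**
`W/ℚ` globally minimal on the habitat (`ρ̄_{E,2^n}` onto, all `n`), `K` imaginary quadratic (`d_K` odd, the two non-squares); the frame of p766882/p767194: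
`w = e_*Q₀` with `Q₀ ∉ 2E(K)`, `2w′ = w`, `σ•w = −w + e_*u₀` with `e_*u₀` of odd order; `σ` MOVES some `u ∈ E[2]` with `σ²u = u` (transposition type:
the K₄⁺ clause).  Then there is `h ∈ Γ_ℚ`, trivial on `E[2]` and on `e_*(E(K))`, such that **one of `σ`, `σh` has NON-ZERO bit and (by p766882
`bit_mul_eq_add`) the other the complementary value** — stated here as `bit(σ) ≠ 0 ∨ bit(σh) ≠ 0`.  §4 supplies `h` with `h•w′ = w′ + u`;
p766882 `exists_bit_ne_zero_of_kummer` does the rest.  Nothing here proves K₄⁺ or BSD.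
[cite: GrossLMS1991, Prop. 9.1, §4 (4.4), §6 Prop. 6.2] [cite: SilvermanAEC2009, VIII.§2] -/
theorem exists_kummer_bit_ne_zero_of_habitat (hK : IsImaginaryQuadratic K) (hodd : Odd (NumberField.discr K))
    (hsq1 : ¬ IsSquare ((NumberField.discr K : ℚ) * -|W.Δ|)) (hsq2 : ¬ IsSquare ((NumberField.discr K : ℚ) * (-(2 * |W.Δ|))))
    (hρ : ∀ n : ℕ, 0 < n → W.HasSurjectiveModNGaloisRep ((2 : ℤ) ^ n))
    {Q₀ u₀ : (W.baseChange K).toAffine.Point} (hQ₀ : ¬ ∃ R : (W.baseChange K).toAffine.Point, (2 : ℤ) • R = Q₀)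
    {w' : W.geomPoints} (hw' : (2 : ℤ) • w' = e Q₀)
    (σ : absoluteGaloisGroup ℚ) (hσw : σ • e Q₀ = -e Q₀ + e u₀) (hoddu : Odd (addOrderOf (e u₀)))
    {u : W.geomPoints} (hu2 : (2 : ℤ) • u = 0) (hu : σ • u ≠ u) (hσσu : σ • (σ • u) = u) :
    ∃ h : absoluteGaloisGroup ℚ, (∀ T : W.geomPoints, (2 : ℤ) • T = 0 → h • T = T) ∧ (∀ X : (W.baseChange K).toAffine.Point, h • e X = e X) ∧
      h • w' = w' + u ∧
      ((σ • (σ • w' + w' - (((addOrderOf (e u₀) + 1) / 2 : ℕ) : ℤ) • e u₀) +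
          (σ • w' + w' - (((addOrderOf (e u₀) + 1) / 2 : ℕ) : ℤ) • e u₀)) ≠ 0 ∨
        ((σ * h) • ((σ * h) • w' + w' - (((addOrderOf (e u₀) + 1) / 2 : ℕ) : ℤ) • e u₀) +
          ((σ * h) • w' + w' - (((addOrderOf (e u₀) + 1) / 2 : ℕ) : ℤ) • e u₀)) ≠ 0) := by
  obtain ⟨h, hfix, hfixK, hhw⟩ := exists_kummer_translate_of_habitat W e he hK hodd hsq1 hsq2 hρ hQ₀ hw' u hu2
  exact ⟨h, hfix, hfixK, hhw, exists_bit_ne_zero_of_kummer σ hu2 hu hσσu hhw (hfixK u₀) hfix hw' hσw hoddu⟩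

end Both

/-! ## §6 (APPEND, same seat) The ZERO value of the bit also occurs: translating the half by the defect `t₁` kills the bit -/

section Zero

variable (W : WeierstrassCurve ℚ) [W.IsElliptic] [W.IsGloballyMinimal] {K : Type} [Field K] [NumberField K]
  (e : (W.baseChange K).toAffine.Point →+ W.geomPoints) (he : e = Affine.Point.map (W' := W) (absEmbedding ℚ K))

include he in
/-- **THE ZERO VALUE OF THE BIT OCCURS TOO** (so «both values» of §5 is literal).  Habitat frame as in §4–§5, `σ` ANY element with `σ•e_*Q₀ = −e_*Q₀ + e_*u₀`
(`e_*u₀` of odd order) such that `σ²` is trivial on `E[2]` (every Zhang–Kolyvagin prime's Frobenius, p766882 `smul_smul_eq_self_of_even_frobeniusTrace`):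
the defect `t₁ = σw′ + w′ − s` is `2`-torsion (p766882 `two_smul_swapDefect_eq_zero`), so §4 gives a Kummer element `h` (trivial on `E[2]` and on
`e_*(E(K))`) with `h•w′ = w′ + t₁`, and then **`bit(σh) = bit(σ) + (σt₁ + t₁) = 2·bit(σ) = 0`** (p766882 `bit_mul_eq_add`).
[cite: GrossLMS1991, Prop. 9.1, §6 Prop. 6.2] [cite: SilvermanAEC2009, VIII.§2] -/
theorem exists_kummer_bit_eq_zero_of_habitat (hK : IsImaginaryQuadratic K) (hodd : Odd (NumberField.discr K))
    (hsq1 : ¬ IsSquare ((NumberField.discr K : ℚ) * -|W.Δ|)) (hsq2 : ¬ IsSquare ((NumberField.discr K : ℚ) * (-(2 * |W.Δ|))))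
    (hρ : ∀ n : ℕ, 0 < n → W.HasSurjectiveModNGaloisRep ((2 : ℤ) ^ n))
    {Q₀ u₀ : (W.baseChange K).toAffine.Point} (hQ₀ : ¬ ∃ R : (W.baseChange K).toAffine.Point, (2 : ℤ) • R = Q₀)
    {w' : W.geomPoints} (hw' : (2 : ℤ) • w' = e Q₀)
    (σ : absoluteGaloisGroup ℚ) (hσw : σ • e Q₀ = -e Q₀ + e u₀) (hoddu : Odd (addOrderOf (e u₀)))
    (hσσ : ∀ T : W.geomPoints, (2 : ℤ) • T = 0 → σ • (σ • T) = T) :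
    ∃ h : absoluteGaloisGroup ℚ, (∀ T : W.geomPoints, (2 : ℤ) • T = 0 → h • T = T) ∧ (∀ X : (W.baseChange K).toAffine.Point, h • e X = e X) ∧
      (σ * h) • ((σ * h) • w' + w' - (((addOrderOf (e u₀) + 1) / 2 : ℕ) : ℤ) • e u₀) +
          ((σ * h) • w' + w' - (((addOrderOf (e u₀) + 1) / 2 : ℕ) : ℤ) • e u₀) = 0 := by
  -- the defect `t₁` is `2`-torsion; translate the half by it
  have ht₁ := two_smul_swapDefect_eq_zero σ hw' hσw hoddu
  obtain ⟨h, hfix, hfixK, hhw⟩ := exists_kummer_translate_of_habitat W e he hK hodd hsq1 hsq2 hρ hQ₀ hw'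
    (σ • w' + w' - (((addOrderOf (e u₀) + 1) / 2 : ℕ) : ℤ) • e u₀) ht₁
  refine ⟨h, hfix, hfixK, ?_⟩
  rw [bit_mul_eq_add σ h hhw (hfixK u₀) hfix hw' hσw hoddu ht₁ (hσσ _ ht₁)]
  -- `bit + bit = 0`: the bit is `2`-torsion
  have h2bit : (2 : ℤ) • (σ • (σ • w' + w' - (((addOrderOf (e u₀) + 1) / 2 : ℕ) : ℤ) • e u₀) +
      (σ • w' + w' - (((addOrderOf (e u₀) + 1) / 2 : ℕ) : ℤ) • e u₀)) = 0 := by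
    rw [smul_add, ← smul_zsmul_geomPoints', ht₁, smul_zero, zero_add]
  rw [← two_smul ℤ, h2bit]

end Zero

end Summit.BirchSwinnertonDyer.BirchSwinnertonDyer.Theorems.GenusSupplyNarrow.SwapRead

end
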